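import Summits.NavierStokesRegularity.NavierStokesRegularity.Theorems.StableStrataDoorClassSlabLevels

/-!
# PeepholeVorticityDoorFramePressure — door S29 «PeepholeVorticityDoor», FILE 4a of the LINE DOC (frame transfer, pressure
# part): a CLASS-UNIFORM gauge point for the pressure of a classical Leray–Hopf solution (nsreg-p6 g15, DIRECTOR-NS #106 (1)(b))

The frame transfer `PVPeepholeRegularityInt → TargetPeepholeVorticity` (FILE 4b) must hand the Pineau–Vicol frame a
pressure that is (i) jointly smooth, so that the rescaled pair is an `IsClassicalNSSolutionOnRegion`, and (ii) bounded in
`L^{3/2}` on the physical cylinder `(a, T) × B(x₀, λ)` by a constant depending on the CLASS `(ν, T, E₀)` only.  The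
classical pressure `p` of the door frame is determined up to a function of time; its gauged version
`q̃ = p − c`, `c(t) = p(t,0) − p̃[u(t)](0)`, equals the normalised (Riesz) pressure `p̃[u(t)]` for a.e. `t`
(`SereginSverak2002.exists_pressure_gauge_of_classical`) and obeys the class bound
`∫₀ᵀ∫|q̃|^{3/2} ≤ P(ν, T, E₀)` (Stein slice-wise + the cubic level, `StableStrataDoorClassSlabLevels`), but `c` is only
measurable.  The way out used here: shift by the VALUE AT A POINT, `p − p(·, x₁)` — jointly smooth for every `x₁` — and
choose `x₁ ∈ B(x₀, λ)` by the first-moment method (`exists_le_setLAverage`) applied to the CONTINUOUS function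
`(t, x, x₁) ↦ |p(t,x) − p(t,x₁)|^{3/2}` (Tonelli is used on it only), using the pointwise identity
`p(t,x) − p(t,x₁) = q̃(t,x) − q̃(t,x₁)`:
`∃ x₁ ∈ B(x₀,λ), ∫_a^T ∫_{B(x₀,λ)} |p(t,x) − p(t,x₁)|^{3/2} dx dt ≤ 2^{3/2} P(ν, T, E₀)` (`exists_pressure_gauge_point`).
-/

noncomputable section

set_option linter.dupNamespace false

namespace Summit.NavierStokesRegularity.NavierStokesRegularity.Theorems.PeepholeVorticityDoor

open MeasureTheory Set Function Filter Topology TopologicalSpace Metric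
open scoped NNReal ENNReal
open Literature.Analysis Literature.Analysis.FluidPDE Literature.Analysis.FluidPDE.SereginSverak2002
open Summit.NavierStokesRegularity.NavierStokesRegularity.Theorems.StableStrataDoorClassSlabLevels
  (lintegral_lintegral_enorm_pow_three_le)

variable {ν T : ℝ} {u : ℝ → EuclideanSpace ℝ (Fin 3) → EuclideanSpace ℝ (Fin 3)}
  {p : ℝ → EuclideanSpace ℝ (Fin 3) → ℝ}

/-- `|α − β|^{3/2} ≤ 2^{1/2} (|α − γ|^{3/2} + |β − γ|^{3/2})` in `ℝ≥0∞` (triangle inequality and convexity of `r ↦ r^{3/2}`). -/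
theorem enorm_sub_rpow_threeHalves_le (α β γ : ℝ) :
    ‖α - β‖ₑ ^ (3 / 2 : ℝ) ≤ 2 ^ (1 / 2 : ℝ) * (‖α - γ‖ₑ ^ (3 / 2 : ℝ) + ‖β - γ‖ₑ ^ (3 / 2 : ℝ)) := by
  have h1 : ‖α - β‖ₑ ≤ ‖α - γ‖ₑ + ‖β - γ‖ₑ := by
    have : α - β = (α - γ) - (β - γ) := by ring
    rw [this]
    exact enorm_sub_le
  calc ‖α - β‖ₑ ^ (3 / 2 : ℝ) ≤ (‖α - γ‖ₑ + ‖β - γ‖ₑ) ^ (3 / 2 : ℝ) := by gcongr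
    _ ≤ 2 ^ ((3 / 2 : ℝ) - 1) * (‖α - γ‖ₑ ^ (3 / 2 : ℝ) + ‖β - γ‖ₑ ^ (3 / 2 : ℝ)) :=
        ENNReal.rpow_add_le_mul_rpow_add_rpow _ _ (by norm_num)
    _ = 2 ^ (1 / 2 : ℝ) * (‖α - γ‖ₑ ^ (3 / 2 : ℝ) + ‖β - γ‖ₑ ^ (3 / 2 : ℝ)) := by norm_num

/-- **Iterated class bound for the gauged pressure** on a time window `(a, T) ⊆ (0, T)`:
`∫_a^T ∫ |p(t,x) − c(t)|^{3/2} dx dt ≤ C_{3/2}^{3/2} (2E₀)^{3/4} K_S^{3/2} (T + E₀/ν)`, `c(t) = p(t,0) − p̃[u(t)](0)`. -/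
theorem lintegral_lintegral_gauged_pressure_le (hν : 0 < ν) (hT : 0 < T)
    (hsol : IsClassicalNSSolutionOn (Ico 0 T) ν 0 u p) (hLH : IsLerayHopfOn T ν 0 (u 0) u)
    {E₀ : ℝ} (hE₀ : VectorCalculus.kineticEnergy (u 0) ≤ E₀) {a : ℝ} (ha : 0 ≤ a) :
    ∫⁻ t in Ioo a T, ∫⁻ x, ‖p t x - (p t 0 - normalisedPressure (u t) 0)‖ₑ ^ (3 / 2 : ℝ) ≤
      (steinConstThreeHalves : ℝ≥0∞) ^ (3 / 2 : ℝ) *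
        (ENNReal.ofReal (2 * E₀) ^ (3 / 4 : ℝ) *
          ((SNormLESNormFDerivOfEqConst (EuclideanSpace ℝ (Fin 3))
              (volume : Measure (EuclideanSpace ℝ (Fin 3))) 2 : ℝ≥0∞) ^ (3 / 2 : ℝ) *
            (ENNReal.ofReal T + ENNReal.ofReal (E₀ / ν)))) := by
  obtain ⟨hgauge, -⟩ := exists_pressure_gauge_of_classical hν hT hsol hLH
  set C₀ : ℝ≥0∞ := (steinConstThreeHalves : ℝ≥0∞) ^ (3 / 2 : ℝ) with hC₀
  have hC₀t : C₀ ≠ ⊤ := ENNReal.rpow_ne_top_of_nonneg (by norm_num) ENNReal.coe_ne_top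
  have hsub : Ioo a T ⊆ Ioo 0 T := Ioo_subset_Ioo_left ha
  have hslice' : ∀ᵐ t ∂(volume.restrict (Ioo a T)),
      ∫⁻ x, ‖p t x - (p t 0 - normalisedPressure (u t) 0)‖ₑ ^ (3 / 2 : ℝ) ≤
        C₀ * ∫⁻ x, ‖u t x‖ₑ ^ (3 : ℕ) := by
    filter_upwards [ae_restrict_of_ae_restrict_of_subset hsub hgauge,
      ae_restrict_mem measurableSet_Ioo] with t ht htI
    have htI' : t ∈ Ioo 0 T := hsub htI
    have hsm : ContDiff ℝ (⊤ : ℕ∞) (u t) := hsol.contDiff_velocity ⟨htI'.1.le, htI'.2⟩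
    have hL2 : Integrable fun y => ‖u t y‖ ^ 2 :=
      (hLH.memLp t ⟨htI'.1.le, htI'.2.le⟩).integrable_norm_pow two_ne_zero
    calc ∫⁻ x, ‖p t x - (p t 0 - normalisedPressure (u t) 0)‖ₑ ^ (3 / 2 : ℝ)
        = ∫⁻ x, ‖normalisedPressure (u t) x‖ₑ ^ (3 / 2 : ℝ) := by simp_rw [ht]
      _ ≤ C₀ * ∫⁻ x, ‖u t x‖ₑ ^ (3 : ℕ) := lintegral_normalisedPressure_rpow_le hsm hL2
  calc ∫⁻ t in Ioo a T, ∫⁻ x, ‖p t x - (p t 0 - normalisedPressure (u t) 0)‖ₑ ^ (3 / 2 : ℝ)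
      ≤ ∫⁻ t in Ioo a T, C₀ * ∫⁻ x, ‖u t x‖ₑ ^ (3 : ℕ) := lintegral_mono_ae hslice'
    _ = C₀ * ∫⁻ t in Ioo a T, ∫⁻ x, ‖u t x‖ₑ ^ (3 : ℕ) := by rw [lintegral_const_mul' _ _ hC₀t]
    _ ≤ C₀ * ∫⁻ t in Ioo 0 T, ∫⁻ x, ‖u t x‖ₑ ^ (3 : ℕ) := by
        rw [hC₀]
        exact mul_le_mul_right (lintegral_mono_set hsub) _
    _ ≤ C₀ * _ := by
        gcongr
        exact lintegral_lintegral_enorm_pow_three_le hν hT hsol hLH hE₀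

/-- **Measurability of the continuous kernel `(x₁, t, x) ↦ |p(t,x) − p(t,x₁)|^{3/2}`** with respect to the product of the
restricted Lebesgue measures on `B × (a,T) × B`, `0 ≤ a` (the pressure is jointly smooth on `[0,T) × ℝ³`). -/
theorem aemeasurable_pressure_osc_kernel (hsol : IsClassicalNSSolutionOn (Ico 0 T) ν 0 u p) {a : ℝ} (ha : 0 ≤ a)
    (B B' : Set (EuclideanSpace ℝ (Fin 3))) :
    AEMeasurable (fun w : (EuclideanSpace ℝ (Fin 3) × ℝ) × EuclideanSpace ℝ (Fin 3) =>
        ‖p w.1.2 w.2 - p w.1.2 w.1.1‖ₑ ^ (3 / 2 : ℝ))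
      (((volume.restrict B).prod (volume.restrict (Ioo a T))).prod (volume.restrict B')) := by
  set S : Set ((EuclideanSpace ℝ (Fin 3) × ℝ) × EuclideanSpace ℝ (Fin 3)) := {w | w.1.2 ∈ Ioo 0 T} with hS
  have hSo : IsOpen S := isOpen_Ioo.preimage (continuous_snd.comp continuous_fst)
  have hpc : ContinuousOn (uncurry p) (Ico 0 T ×ˢ univ) := hsol.smooth_pressure.continuousOn
  have h1 : ContinuousOn (fun w : (EuclideanSpace ℝ (Fin 3) × ℝ) × EuclideanSpace ℝ (Fin 3) => p w.1.2 w.2) S := by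
    refine hpc.comp ((continuous_snd.comp continuous_fst).prodMk continuous_snd).continuousOn ?_
    intro w hw
    exact mk_mem_prod (Ioo_subset_Ico_self hw) (mem_univ _)
  have h2 : ContinuousOn (fun w : (EuclideanSpace ℝ (Fin 3) × ℝ) × EuclideanSpace ℝ (Fin 3) => p w.1.2 w.1.1) S := by
    refine hpc.comp ((continuous_snd.comp continuous_fst).prodMk (continuous_fst.comp continuous_fst)).continuousOn ?_
    intro w hw
    exact mk_mem_prod (Ioo_subset_Ico_self hw) (mem_univ _)
  have h3 : ContinuousOn (fun w : (EuclideanSpace ℝ (Fin 3) × ℝ) × EuclideanSpace ℝ (Fin 3) =>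
      ‖p w.1.2 w.2 - p w.1.2 w.1.1‖ₑ ^ (3 / 2 : ℝ)) S :=
    ENNReal.continuous_rpow_const.comp_continuousOn (h1.sub h2).enorm
  have h4 : AEMeasurable (fun w : (EuclideanSpace ℝ (Fin 3) × ℝ) × EuclideanSpace ℝ (Fin 3) =>
      ‖p w.1.2 w.2 - p w.1.2 w.1.1‖ₑ ^ (3 / 2 : ℝ)) (volume.restrict S) :=
    h3.aemeasurable hSo.measurableSet
  refine h4.mono_measure ?_
  rw [Measure.prod_restrict, Measure.prod_restrict, ← Measure.volume_eq_prod, ← Measure.volume_eq_prod]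
  refine Measure.restrict_mono_set _ ?_
  intro w hw
  exact Ioo_subset_Ioo_left ha hw.1.2

/-- **The class-uniform gauge point.**  For a classical Leray–Hopf solution `(u, p)` on `[0,T)` with initial kinetic
energy `≤ E₀`, a time `0 ≤ a < T`, a centre `x₀` and a radius `λ > 0`, there is `x₁ ∈ B(x₀, λ)` with
`∫_a^T ∫_{B(x₀,λ)} |p(t,x) − p(t,x₁)|^{3/2} dx dt ≤ 2^{3/2} · C_{3/2}^{3/2} (2E₀)^{3/4} K_S^{3/2} (T + E₀/ν)`
(first-moment method on `x₁`, the pointwise identity `p(t,x) − p(t,x₁) = q̃(t,x) − q̃(t,x₁)` for the gauged pressure `q̃`,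
and the class bound of `lintegral_lintegral_gauged_pressure_le`). -/
theorem exists_pressure_gauge_point (hν : 0 < ν) (hT : 0 < T)
    (hsol : IsClassicalNSSolutionOn (Ico 0 T) ν 0 u p) (hLH : IsLerayHopfOn T ν 0 (u 0) u)
    {E₀ : ℝ} (hE₀ : VectorCalculus.kineticEnergy (u 0) ≤ E₀) {a : ℝ} (ha : 0 ≤ a)
    (x₀ : EuclideanSpace ℝ (Fin 3)) {l : ℝ} (hl : 0 < l) :
    ∃ x₁ ∈ ball x₀ l, ∫⁻ t in Ioo a T, ∫⁻ x in ball x₀ l, ‖p t x - p t x₁‖ₑ ^ (3 / 2 : ℝ) ≤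
      2 ^ (3 / 2 : ℝ) * ((steinConstThreeHalves : ℝ≥0∞) ^ (3 / 2 : ℝ) *
        (ENNReal.ofReal (2 * E₀) ^ (3 / 4 : ℝ) *
          ((SNormLESNormFDerivOfEqConst (EuclideanSpace ℝ (Fin 3))
              (volume : Measure (EuclideanSpace ℝ (Fin 3))) 2 : ℝ≥0∞) ^ (3 / 2 : ℝ) *
            (ENNReal.ofReal T + ENNReal.ofReal (E₀ / ν))))) := by
  set B : Set (EuclideanSpace ℝ (Fin 3)) := ball x₀ l with hBdef
  set I : Set ℝ := Ioo a T with hIdef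
  set P : ℝ≥0∞ := (steinConstThreeHalves : ℝ≥0∞) ^ (3 / 2 : ℝ) *
        (ENNReal.ofReal (2 * E₀) ^ (3 / 4 : ℝ) *
          ((SNormLESNormFDerivOfEqConst (EuclideanSpace ℝ (Fin 3))
              (volume : Measure (EuclideanSpace ℝ (Fin 3))) 2 : ℝ≥0∞) ^ (3 / 2 : ℝ) *
            (ENNReal.ofReal T + ENNReal.ofReal (E₀ / ν)))) with hPdef
  set c : ℝ → ℝ := fun t => p t 0 - normalisedPressure (u t) 0 with hcdef
  -- the gauged slices `A t x = |p(t,x) − c(t)|^{3/2}` and the kernel `F`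
  set A : ℝ → EuclideanSpace ℝ (Fin 3) → ℝ≥0∞ := fun t x => ‖p t x - c t‖ₑ ^ (3 / 2 : ℝ) with hAdef
  set F : EuclideanSpace ℝ (Fin 3) → ℝ → EuclideanSpace ℝ (Fin 3) → ℝ≥0∞ :=
    fun x₁ t x => ‖p t x - p t x₁‖ₑ ^ (3 / 2 : ℝ) with hFdef
  have hB0 : volume B ≠ 0 := (measure_ball_pos volume x₀ hl).ne'
  have hBt : volume B ≠ ⊤ := measure_ball_lt_top.ne
  have hclass : ∫⁻ t in I, ∫⁻ x, A t x ≤ P := lintegral_lintegral_gauged_pressure_le hν hT hsol hLH hE₀ ha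
  -- pointwise: `F x₁ t x ≤ 2^{1/2} (A t x + A t x₁)`
  have hFle : ∀ x₁ t x, F x₁ t x ≤ 2 ^ (1 / 2 : ℝ) * (A t x + A t x₁) := fun x₁ t x =>
    enorm_sub_rpow_threeHalves_le _ _ _
  -- measurability of `A t ·` for `t ∈ (0,T)` and of the kernel
  have hAm : ∀ t ∈ I, Measurable (A t) := fun t ht => by
    have hpt : Continuous (p t) := (hsol.contDiff_pressure ⟨(ha.trans ht.1.le), ht.2⟩).continuous
    exact (hpt.sub continuous_const).measurable.enorm.pow_const _
  have hker := aemeasurable_pressure_osc_kernel hsol ha B B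
  -- `G x₁ t = ∫_B F`, `H x₁ = ∫_I G`
  have hG : AEMeasurable (uncurry fun x₁ t => ∫⁻ x in B, F x₁ t x) ((volume.restrict B).prod (volume.restrict I)) :=
    hker.lintegral_prod_right'
  have hH : AEMeasurable (fun x₁ => ∫⁻ t in I, ∫⁻ x in B, F x₁ t x) (volume.restrict B) :=
    hG.lintegral_prod_right'
  -- the inner bound at a good time
  have h2top : (2 : ℝ≥0∞) ^ (1 / 2 : ℝ) ≠ ⊤ := ENNReal.rpow_ne_top_of_nonneg (by norm_num) ENNReal.ofNat_ne_top
  have h232top : (2 : ℝ≥0∞) ^ (3 / 2 : ℝ) ≠ ⊤ := ENNReal.rpow_ne_top_of_nonneg (by norm_num) ENNReal.ofNat_ne_top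
  have h232 : (2 : ℝ≥0∞) ^ (1 / 2 : ℝ) * 2 = 2 ^ (3 / 2 : ℝ) := by
    rw [show (3 / 2 : ℝ) = 1 / 2 + 1 by norm_num, ENNReal.rpow_add _ _ two_ne_zero ENNReal.ofNat_ne_top,
      ENNReal.rpow_one]
  have hinner : ∀ t ∈ I, ∫⁻ x₁ in B, ∫⁻ x in B, F x₁ t x ≤ 2 ^ (3 / 2 : ℝ) * volume B * ∫⁻ x, A t x := by
    intro t ht
    have hm := hAm t ht
    calc ∫⁻ x₁ in B, ∫⁻ x in B, F x₁ t x
        ≤ ∫⁻ x₁ in B, ∫⁻ x in B, 2 ^ (1 / 2 : ℝ) * (A t x + A t x₁) :=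
          lintegral_mono fun x₁ => lintegral_mono fun x => hFle x₁ t x
      _ = ∫⁻ x₁ in B, 2 ^ (1 / 2 : ℝ) * ((∫⁻ x in B, A t x) + A t x₁ * volume B) := by
          refine lintegral_congr fun x₁ => ?_
          rw [lintegral_const_mul' _ _ h2top, lintegral_add_left hm, setLIntegral_const]
      _ = 2 ^ (1 / 2 : ℝ) * ((∫⁻ x in B, A t x) * volume B + (∫⁻ x₁ in B, A t x₁) * volume B) := by
          rw [lintegral_const_mul' _ _ h2top, lintegral_add_right _ (hm.mul_const _), setLIntegral_const,
            lintegral_mul_const _ hm]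
      _ = 2 ^ (1 / 2 : ℝ) * 2 * volume B * ∫⁻ x in B, A t x := by ring
      _ = 2 ^ (3 / 2 : ℝ) * volume B * ∫⁻ x in B, A t x := by rw [h232]
      _ ≤ 2 ^ (3 / 2 : ℝ) * volume B * ∫⁻ x, A t x := by
          gcongr
          exact Measure.restrict_le_self
  -- swap `x₁` and `t`, integrate the inner bound
  have hswap : ∫⁻ x₁ in B, ∫⁻ t in I, ∫⁻ x in B, F x₁ t x = ∫⁻ t in I, ∫⁻ x₁ in B, ∫⁻ x in B, F x₁ t x :=
    lintegral_lintegral_swap hG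
  have htotal : ∫⁻ x₁ in B, ∫⁻ t in I, ∫⁻ x in B, F x₁ t x ≤ 2 ^ (3 / 2 : ℝ) * P * volume B := by
    rw [hswap]
    calc ∫⁻ t in I, ∫⁻ x₁ in B, ∫⁻ x in B, F x₁ t x
        ≤ ∫⁻ t in I, 2 ^ (3 / 2 : ℝ) * volume B * ∫⁻ x, A t x :=
          setLIntegral_mono' measurableSet_Ioo fun t ht => hinner t ht
      _ = 2 ^ (3 / 2 : ℝ) * volume B * ∫⁻ t in I, ∫⁻ x, A t x := by
          rw [lintegral_const_mul' _ _ (ENNReal.mul_ne_top h232top hBt)]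
      _ ≤ 2 ^ (3 / 2 : ℝ) * volume B * P := by gcongr
      _ = 2 ^ (3 / 2 : ℝ) * P * volume B := by ring
  -- first moment in `x₁`
  obtain ⟨x₁, hx₁, hle⟩ := exists_le_setLAverage hB0 hBt hH
  refine ⟨x₁, hx₁, hle.trans ?_⟩
  rw [setLAverage_eq]
  calc (∫⁻ x₁ in B, ∫⁻ t in I, ∫⁻ x in B, F x₁ t x) / volume B
      ≤ (2 ^ (3 / 2 : ℝ) * P * volume B) / volume B := by gcongr
    _ = 2 ^ (3 / 2 : ℝ) * P := ENNReal.mul_div_cancel_right hB0 hBt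

end Summit.NavierStokesRegularity.NavierStokesRegularity.Theorems.PeepholeVorticityDoor

end
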